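import Summits.ResolutionOfSingularities.ResolutionOfSingularities.Theorems.WeightedInvariantIota3JSigmaDominanceGeneric
import HarnessLib

/-!
# (o70-b) PART 2a — ONE-SIDED DOMINANCE OF TWO-FLAGS IS MUTUAL (the upgrade lemma)
# (door `HypersurfaceCentreConstruction`, stmt-ResolutionOfSingularities-19897; clause h8 ⟸ (σ-pres)₃ ⟸ (o70-a) + (o70-b) + (o70-x);
# SPEC (Δ12) rev 2 `L/res-L1-w43-plan-1/JSigmaCanon_sketch.lean` aceffaa8e08fb006 of res-L1-w43-plan-1; hand res-D-brk-1)

Topic: `Summits/ResolutionOfSingularities/ResolutionOfSingularities/Theorems`. Helper for the door item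
`HypersurfaceCentreConstruction` (stmt-ResolutionOfSingularities-19897, route `WeightedInvariant`), line `local-engine`
(L W4.3), def-free, pure local algebra (any local ring).  (J-can) is MUTUAL dominance of two σ-maximising two-flags
(`flagContactFiltration_eq_of_mem_of_mem`, p533944).  This file halves it:

* `IsTwoFlag.dominant_symm` — **the upgrade lemma**: if `(g₁, g₂)` is a two-flag, `g₁', g₂' ∈ 𝔪`, `(q; r₁, r₂)` is admissible and
  `g₁ ∈ F'(r₁)`, `g₂ ∈ F'(r₂)` (the flag `(g₁, g₂)` sits inside the filtration `F'` of `(g₁', g₂')`), then conversely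
  `g₁' ∈ F(r₁)`, `g₂' ∈ F(r₂)`.  Three regimes: `r₂ = q` (`F'(r₁) ≤ (g₁') + 𝔪^⌈r₁/q⌉`, PART 1); `q < r₂ < r₁`
  (`g₁ = a'g₁' + n`, `g₂ = a g₁' + b g₂' + m` with `n, m ∈ 𝔪²`, the two-flag property makes `a'`, `b` units, and one solves modulo
  `F(r₂)`); `q < r₂ = r₁` (a `2 × 2` system whose determinant is a unit by the two-flag property, Cramer);
* `flagContactFiltration_eq_of_oneSided` — hence ONE-SIDED dominance already gives EQUAL filtrations;
* structural lemmas `flagContactFiltration_le_span_sup_zero_left`, `flagContactFiltration_zero_left_le`,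
  `flagContactFiltration_zero_left_weight₁_le`, `flagContactFiltration_weight₂_le`.

[OURS · L1 W4.3 · (o70-b) PART 2a]  Replaces the role of NO printed item; NOT a statement of the manuscript
[claim: Hironaka2017, status: under-review]. AI work, weaker than expert review.  No named facts.

## References

* H. Matsumura, *Commutative Ring Theory* (1987), Thm. 2.3 (Nakayama; minimal bases of `𝔪`). [Matsumura1987]
* D. Abramovich, M. H. Quek, B. Schober, arXiv:2507.01232v3, Thm 3.5 (c) (dimension two). [AbramovichQuekSchober2025]
-/

noncomputable section

set_option linter.dupNamespace false -- mandated namespace `Summit.<Summit>.<Problem>` of this single-conjunct summit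

open IsLocalRing Literature.AlgebraicGeometry.Resolution
open Summit.ResolutionOfSingularities.ResolutionOfSingularities.Theorems

namespace Summit.ResolutionOfSingularities.ResolutionOfSingularities.Cruxes.HypersurfaceCentreConstruction.LocalEngine

namespace Iota3

universe u

variable {S : Type u} [CommRing S] [IsLocalRing S]

/-! ## §1 Structure of the low levels of a two-flag filtration -/

/-- Splitting off the first member: `F_{(g₁,g₂)}(n) ≤ (g₁) ⊔ F_{(0,g₂)}(n)` (the pieces with `α ≥ 1` lie in `(g₁)`, those with `α = 0`
are pieces of the filtration of `(0, g₂)`). [folklore] -/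
theorem flagContactFiltration_le_span_sup_zero_left (g₁ g₂ : S) (q r₁ r₂ n : ℕ) :
    flagContactFiltration g₁ g₂ q r₁ r₂ n ≤ Ideal.span {g₁} ⊔ flagContactFiltration 0 g₂ q r₁ r₂ n := by
  rw [flagContactFiltration_def g₁]
  refine iSup_le fun α => iSup_le fun β => ?_
  rcases Nat.eq_zero_or_pos α with hα | hα
  · subst hα
    refine le_sup_of_le_right ?_
    have h := flagPiece_le (0 : S) g₂ q r₁ r₂ n 0 β
    simp only [pow_zero, one_mul] at h ⊢
    exact h
  · refine le_sup_of_le_left ((Ideal.mul_le_right).trans ?_)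
    rw [Ideal.span_singleton_le_span_singleton]
    exact (dvd_pow_self g₁ hα.ne').mul_right _

/-- The filtration of `(0, g₂)` lies in that of `(h, g₂)` for every `h`. [folklore] -/
theorem flagContactFiltration_zero_left_le (h g₂ : S) (q r₁ r₂ n : ℕ) :
    flagContactFiltration 0 g₂ q r₁ r₂ n ≤ flagContactFiltration h g₂ q r₁ r₂ n := by
  rw [flagContactFiltration_def (0 : S)]
  refine iSup_le fun α => iSup_le fun β => ?_
  rcases Nat.eq_zero_or_pos α with hα | hα
  · subst hα
    have hp := flagPiece_le h g₂ q r₁ r₂ n 0 β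
    simp only [pow_zero, one_mul] at hp ⊢
    exact hp
  · rw [zero_pow hα.ne', zero_mul, Ideal.span_singleton_zero, Ideal.bot_mul]
    exact bot_le

/-- For `r₂ < r₁`, `g₂ ∈ 𝔪`: `F_{(0,g₂)}(r₁) ≤ (g₂)·𝔪 ⊔ 𝔪^⌈r₁/q⌉` (the piece `g₂·𝔪^⌈(r₁−r₂)/q⌉` has a positive exponent). [folklore] -/
theorem flagContactFiltration_zero_left_weight₁_le {g₂ : S} (hg₂ : g₂ ∈ maximalIdeal S) {q r₁ r₂ : ℕ} (hq : 0 < q)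
    (hr : r₂ < r₁) :
    flagContactFiltration 0 g₂ q r₁ r₂ r₁ ≤ Ideal.span {g₂} * maximalIdeal S ⊔ maximalIdeal S ^ ((r₁ + q - 1) / q) := by
  rw [flagContactFiltration_def]
  refine iSup_le fun α => iSup_le fun β => ?_
  rcases Nat.eq_zero_or_pos α with hα | hα
  · subst hα
    rw [pow_zero, one_mul, Nat.mul_zero, Nat.sub_zero]
    rcases Nat.eq_zero_or_pos β with hβ | hβ
    · subst hβ
      rw [pow_zero, Ideal.span_singleton_one, Ideal.top_mul, Nat.mul_zero, Nat.sub_zero]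
      exact le_sup_right
    · refine le_sup_of_le_left ?_
      rcases Nat.lt_or_ge β 2 with hβ1 | hβ2
      · obtain rfl : β = 1 := by omega
        rw [pow_one, mul_one]
        refine Ideal.mul_mono_right (Ideal.pow_le_self ?_)
        have : 1 ≤ (r₁ - r₂ + q - 1) / q := by rw [Nat.le_div_iff_mul_le hq]; omega
        omega
      · calc Ideal.span {g₂ ^ β} * maximalIdeal S ^ ((r₁ - r₂ * β + q - 1) / q) ≤ Ideal.span {g₂ ^ β} := Ideal.mul_le_right
          _ ≤ Ideal.span {g₂} * Ideal.span {g₂} := by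
              rw [Ideal.span_singleton_mul_span_singleton, Ideal.span_singleton_le_span_singleton, ← pow_two]
              exact pow_dvd_pow g₂ hβ2
          _ ≤ Ideal.span {g₂} * maximalIdeal S :=
              Ideal.mul_mono_right ((Ideal.span_singleton_le_iff_mem _).mpr hg₂)
  · rw [zero_pow hα.ne', zero_mul, Ideal.span_singleton_zero, Ideal.bot_mul]
    exact bot_le

/-- The second weight level: `F_{(g₁,g₂)}(r₂) ≤ (g₁) ⊔ (g₂) ⊔ 𝔪^⌈r₂/q⌉`. [folklore] -/
theorem flagContactFiltration_weight₂_le (g₁ g₂ : S) (q r₁ r₂ : ℕ) :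
    flagContactFiltration g₁ g₂ q r₁ r₂ r₂ ≤ (Ideal.span {g₁} ⊔ Ideal.span {g₂}) ⊔ maximalIdeal S ^ ((r₂ + q - 1) / q) := by
  rw [flagContactFiltration_def]
  refine iSup_le fun α => iSup_le fun β => ?_
  rcases Nat.eq_zero_or_pos α with hα | hα
  · subst hα
    rcases Nat.eq_zero_or_pos β with hβ | hβ
    · subst hβ
      rw [pow_zero, pow_zero, one_mul, Ideal.span_singleton_one, Ideal.top_mul, Nat.mul_zero, Nat.mul_zero, Nat.sub_zero,
        Nat.sub_zero]
      exact le_sup_right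
    · refine le_sup_of_le_left (le_sup_of_le_right ((Ideal.mul_le_right).trans ?_))
      rw [pow_zero, one_mul, Ideal.span_singleton_le_span_singleton]
      exact dvd_pow_self g₂ hβ.ne'
  · refine le_sup_of_le_left (le_sup_of_le_left ((Ideal.mul_le_right).trans ?_))
    rw [Ideal.span_singleton_le_span_singleton]
    exact (dvd_pow_self g₁ hα.ne').mul_right _

/-! ## §2 The upgrade lemma -/

/-- **THE UPGRADE LEMMA: one-sided dominance of two-flags is mutual.** If `(g₁, g₂)` is a two-flag, `g₁', g₂' ∈ 𝔪`, `(q; r₁, r₂)` is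
admissible, and `g₁ ∈ F_{(g₁',g₂')}(r₁)`, `g₂ ∈ F_{(g₁',g₂')}(r₂)`, then `g₁' ∈ F_{(g₁,g₂)}(r₁)` and `g₂' ∈ F_{(g₁,g₂)}(r₂)`.
[OURS · L1 W4.3 · (o70-b)] -/
theorem IsTwoFlag.dominant_symm {g₁ g₂ g₁' g₂' : S} {q r₁ r₂ : ℕ} (hΦ : IsTwoFlag g₁ g₂) (hadm : AdmissibleTriple q r₁ r₂)
    (hg₁' : g₁' ∈ maximalIdeal S) (hg₂' : g₂' ∈ maximalIdeal S)
    (h₁ : g₁ ∈ flagContactFiltration g₁' g₂' q r₁ r₂ r₁) (h₂ : g₂ ∈ flagContactFiltration g₁' g₂' q r₁ r₂ r₂) :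
    g₁' ∈ flagContactFiltration g₁ g₂ q r₁ r₂ r₁ ∧ g₂' ∈ flagContactFiltration g₁ g₂ q r₁ r₂ r₂ := by
  obtain ⟨hq, hq₂, h₂₁⟩ := hadm
  have hself := self_mem_flagContactFiltration g₁ g₂ r₁ r₂ hq
  have hg₁r₂ : g₁ ∈ flagContactFiltration g₁ g₂ q r₁ r₂ r₂ := flagContactFiltration_antitone g₁ g₂ q r₁ r₂ h₂₁ hself.1
  have hpow₂ : maximalIdeal S ^ ((r₂ + q - 1) / q) ≤ flagContactFiltration g₁ g₂ q r₁ r₂ r₂ := fun m hm =>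
    mem_flagContactFiltration_of_mem_pow hq hm (by simpa using le_add_mul_cdiv hq r₂ 0)
  have hpow₁ : maximalIdeal S ^ ((r₁ + q - 1) / q) ≤ flagContactFiltration g₁ g₂ q r₁ r₂ r₁ := fun m hm =>
    mem_flagContactFiltration_of_mem_pow hq hm (by simpa using le_add_mul_cdiv hq r₁ 0)
  have hc₁₂ : maximalIdeal S ^ ((r₁ + q - 1) / q) ≤ maximalIdeal S ^ ((r₂ + q - 1) / q) :=
    Ideal.pow_le_pow_right (Nat.div_le_div_right (by omega))
  rcases Nat.lt_or_ge q r₂ with hqr₂ | hqr₂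
  · -- `q < r₂`: both ceilings are `≥ 2`
    have hc₂ : 2 ≤ (r₂ + q - 1) / q := by rw [Nat.le_div_iff_mul_le hq]; omega
    have hm2₂ : maximalIdeal S ^ ((r₂ + q - 1) / q) ≤ maximalIdeal S ^ 2 := Ideal.pow_le_pow_right hc₂
    have hm2₁ : maximalIdeal S ^ ((r₁ + q - 1) / q) ≤ maximalIdeal S ^ 2 := hc₁₂.trans hm2₂
    -- `g₂ = a g₁' + b g₂' + m`
    obtain ⟨ab, hab, m, hm, hsum₂⟩ := Submodule.mem_sup.mp (flagContactFiltration_weight₂_le g₁' g₂' q r₁ r₂ h₂)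
    obtain ⟨a₁, ha₁, b₁, hb₁, hab⟩ := Submodule.mem_sup.mp hab
    obtain ⟨a, rfl⟩ := Ideal.mem_span_singleton'.mp ha₁
    obtain ⟨b, rfl⟩ := Ideal.mem_span_singleton'.mp hb₁
    rcases Nat.lt_or_ge r₂ r₁ with hr | hr
    · -- regime `q < r₂ < r₁`: `g₁ = a' g₁' + n`, `n = g₂' t + m₁`
      obtain ⟨a₁', ha₁', n, hn, hsum₁⟩ := Submodule.mem_sup.mp (flagContactFiltration_le_span_sup_zero_left g₁' g₂' q r₁ r₂ r₁ h₁)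
      obtain ⟨a', rfl⟩ := Ideal.mem_span_singleton'.mp ha₁'
      obtain ⟨n₁, hn₁, m₁, hm₁, hnsum⟩ := Submodule.mem_sup.mp (flagContactFiltration_zero_left_weight₁_le hg₂' hq hr hn)
      obtain ⟨t, ht, rfl⟩ := Ideal.mem_span_singleton_mul.mp hn₁
      have hn2 : n ∈ maximalIdeal S ^ 2 := by
        rw [← hnsum, pow_two]
        exact Ideal.add_mem _ (Ideal.mul_mem_mul hg₂' ht) ((pow_two (maximalIdeal S)) ▸ hm2₁ hm₁)
      -- `a'` is a unit
      have ha' : IsUnit a' := by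
        by_contra hu
        have ha'm : a' ∈ maximalIdeal S := (IsLocalRing.mem_maximalIdeal _).mpr hu
        refine hΦ.left_not_mem_sq ?_
        rw [← hsum₁, pow_two]
        exact Ideal.add_mem _ (Ideal.mul_mem_mul ha'm hg₁') ((pow_two (maximalIdeal S)) ▸ hn2)
      obtain ⟨a'u, rfl⟩ := ha'
      -- `b` is a unit
      have hb : IsUnit b := by
        by_contra hu
        have hbm : b ∈ maximalIdeal S := (IsLocalRing.mem_maximalIdeal _).mpr hu
        have key : (-(a * ↑a'u⁻¹)) * g₁ + 1 * g₂ ∈ maximalIdeal S ^ 2 := by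
          have : (-(a * ↑a'u⁻¹)) * g₁ + 1 * g₂ = b * g₂' + m - a * ↑a'u⁻¹ * n := by
            rw [← hsum₁, ← hsum₂, ← hab]
            have h1 : (a'u⁻¹ : Sˣ).val * (a'u : Sˣ).val = 1 := by simp
            linear_combination (-(a * g₁') + 0) * h1
          rw [this, pow_two]
          refine Ideal.sub_mem _ (Ideal.add_mem _ (Ideal.mul_mem_mul hbm hg₂') ((pow_two (maximalIdeal S)) ▸ hm2₂ hm)) ?_
          exact Ideal.mul_mem_left _ _ ((pow_two (maximalIdeal S)) ▸ hn2)
        have := (hΦ.2.2 _ _ key).2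
        exact (IsLocalRing.maximalIdeal.isMaximal S).ne_top (Ideal.eq_top_of_isUnit_mem _ this isUnit_one)
      -- solve for `g₂'` modulo `F(r₂)`
      have hu : IsUnit (b - a * ↑a'u⁻¹ * t) := by
        by_contra h
        refine (IsLocalRing.mem_maximalIdeal _).mp ?_ hb
        have := Ideal.add_mem _ ((IsLocalRing.mem_maximalIdeal _).mpr h) (Ideal.mul_mem_left _ (a * ↑a'u⁻¹) ht)
        rwa [sub_add_cancel] at this
      obtain ⟨w, hw⟩ := hu
      have hg₂'F : g₂' ∈ flagContactFiltration g₁ g₂ q r₁ r₂ r₂ := by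
        have hid : (w : S) * g₂' = g₂ - m - a * ↑a'u⁻¹ * g₁ + a * ↑a'u⁻¹ * m₁ := by
          rw [hw, ← hsum₂, ← hab, ← hsum₁, ← hnsum]
          have h1 : (a'u⁻¹ : Sˣ).val * (a'u : Sˣ).val = 1 := by simp
          linear_combination (a * g₁') * h1
        have hmem : (w : S) * g₂' ∈ flagContactFiltration g₁ g₂ q r₁ r₂ r₂ := by
          rw [hid]
          refine Ideal.add_mem _ (Ideal.sub_mem _ (Ideal.sub_mem _ hself.2 (hpow₂ hm)) (Ideal.mul_mem_left _ _ hg₁r₂)) ?_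
          exact Ideal.mul_mem_left _ _ (hpow₂ (hc₁₂ hm₁))
        have := Ideal.mul_mem_left _ (↑w⁻¹ : S) hmem
        rwa [← mul_assoc, Units.inv_mul, one_mul] at this
      refine ⟨?_, hg₂'F⟩
      -- `g₁' = a'⁻¹ (g₁ - n)` with `n ∈ F_{(0,g₂')}(r₁) ≤ F_{(g₁,g₂')}(r₁) ≤ F_{(g₁,g₂)}(r₁)`
      have hnF : n ∈ flagContactFiltration g₁ g₂ q r₁ r₂ r₁ :=
        flagContactFiltration_le_of_mem hq hself.1 hg₂'F r₁ (flagContactFiltration_zero_left_le g₁ g₂' q r₁ r₂ r₁ hn)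
      have hid : g₁' = ↑a'u⁻¹ * (g₁ - n) := by
        rw [← hsum₁, add_sub_cancel_right, ← mul_assoc, Units.inv_mul, one_mul]
      rw [hid]
      exact Ideal.mul_mem_left _ _ (Ideal.sub_mem _ hself.1 hnF)
    · -- regime `q < r₂ = r₁`: a `2 × 2` system
      obtain rfl : r₂ = r₁ := le_antisymm h₂₁ hr
      obtain ⟨ab', hab', m', hm', hsum₁⟩ := Submodule.mem_sup.mp (flagContactFiltration_weight₂_le g₁' g₂' q r₂ r₂ h₁)
      obtain ⟨a₂, ha₂, b₂, hb₂, hab'⟩ := Submodule.mem_sup.mp hab'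
      obtain ⟨a', rfl⟩ := Ideal.mem_span_singleton'.mp ha₂
      obtain ⟨b', rfl⟩ := Ideal.mem_span_singleton'.mp hb₂
      -- `g₁ = a' g₁' + b' g₂' + m'`, `g₂ = a g₁' + b g₂' + m`; the determinant `a' b - b' a` is a unit
      have hdet : IsUnit (a' * b - b' * a) := by
        by_contra hu
        have hdm : a' * b - b' * a ∈ maximalIdeal S := (IsLocalRing.mem_maximalIdeal _).mpr hu
        -- `b g₁ - b' g₂ = det · g₁' + (b m' - b' m)` and `a g₁ - a' g₂ = -det · g₂' + (a m' - a' m)`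
        have k1 : b * g₁ + (-b') * g₂ ∈ maximalIdeal S ^ 2 := by
          have : b * g₁ + (-b') * g₂ = (a' * b - b' * a) * g₁' + (b * m' - b' * m) := by
            rw [← hsum₁, ← hsum₂, ← hab, ← hab']; ring
          rw [this, pow_two]
          refine Ideal.add_mem _ (Ideal.mul_mem_mul hdm hg₁') (Ideal.sub_mem _ ?_ ?_)
          · exact Ideal.mul_mem_left _ _ ((pow_two (maximalIdeal S)) ▸ hm2₂ hm')
          · exact Ideal.mul_mem_left _ _ ((pow_two (maximalIdeal S)) ▸ hm2₂ hm)
        have k2 : a * g₁ + (-a') * g₂ ∈ maximalIdeal S ^ 2 := by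
          have : a * g₁ + (-a') * g₂ = -((a' * b - b' * a) * g₂') + (a * m' - a' * m) := by
            rw [← hsum₁, ← hsum₂, ← hab, ← hab']; ring
          rw [this, pow_two]
          refine Ideal.add_mem _ (Submodule.neg_mem _ (Ideal.mul_mem_mul hdm hg₂')) (Ideal.sub_mem _ ?_ ?_)
          · exact Ideal.mul_mem_left _ _ ((pow_two (maximalIdeal S)) ▸ hm2₂ hm')
          · exact Ideal.mul_mem_left _ _ ((pow_two (maximalIdeal S)) ▸ hm2₂ hm)
        have hbm : b ∈ maximalIdeal S := (hΦ.2.2 _ _ k1).1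
        have hb'm : b' ∈ maximalIdeal S := by simpa using (hΦ.2.2 _ _ k1).2
        have ham : a ∈ maximalIdeal S := (hΦ.2.2 _ _ k2).1
        have ha'm : a' ∈ maximalIdeal S := by simpa using (hΦ.2.2 _ _ k2).2
        refine hΦ.left_not_mem_sq ?_
        rw [← hsum₁, ← hab', pow_two]
        exact Ideal.add_mem _ (Ideal.add_mem _ (Ideal.mul_mem_mul ha'm hg₁') (Ideal.mul_mem_mul hb'm hg₂'))
          ((pow_two (maximalIdeal S)) ▸ hm2₂ hm')
      obtain ⟨d, hd⟩ := hdet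
      have hF₁ : g₁ - m' ∈ flagContactFiltration g₁ g₂ q r₂ r₂ r₂ := Ideal.sub_mem _ hself.1 (hpow₂ hm')
      have hF₂ : g₂ - m ∈ flagContactFiltration g₁ g₂ q r₂ r₂ r₂ := Ideal.sub_mem _ hself.2 (hpow₂ hm)
      have e₁ : (d : S) * g₁' = b * (g₁ - m') - b' * (g₂ - m) := by
        rw [hd, ← hsum₁, ← hsum₂, ← hab, ← hab']; ring
      have e₂ : (d : S) * g₂' = a' * (g₂ - m) - a * (g₁ - m') := by
        rw [hd, ← hsum₁, ← hsum₂, ← hab, ← hab']; ring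
      have hG₁ : (d : S) * g₁' ∈ flagContactFiltration g₁ g₂ q r₂ r₂ r₂ := by
        rw [e₁]; exact Ideal.sub_mem _ (Ideal.mul_mem_left _ _ hF₁) (Ideal.mul_mem_left _ _ hF₂)
      have hG₂ : (d : S) * g₂' ∈ flagContactFiltration g₁ g₂ q r₂ r₂ r₂ := by
        rw [e₂]; exact Ideal.sub_mem _ (Ideal.mul_mem_left _ _ hF₂) (Ideal.mul_mem_left _ _ hF₁)
      constructor
      · have := Ideal.mul_mem_left _ (↑d⁻¹ : S) hG₁
        rwa [← mul_assoc, Units.inv_mul, one_mul] at this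
      · have := Ideal.mul_mem_left _ (↑d⁻¹ : S) hG₂
        rwa [← mul_assoc, Units.inv_mul, one_mul] at this
  · -- regime `r₂ = q`
    obtain rfl : r₂ = q := le_antisymm hqr₂ hq₂
    refine ⟨?_, maximalIdeal_le_flagContactFiltration g₁ g₂ r₁ r₂ hq hg₂'⟩
    rcases Nat.lt_or_ge r₂ r₁ with hr | hr
    · have hc₁ : 2 ≤ (r₁ + r₂ - 1) / r₂ := by rw [Nat.le_div_iff_mul_le hq]; omega
      obtain ⟨s, hs, m, hm, hsum⟩ := Submodule.mem_sup.mp (flagContactFiltration_le_span_sup_pow hg₂' hq r₁ r₁ h₁)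
      obtain ⟨a, rfl⟩ := Ideal.mem_span_singleton'.mp hs
      have ha : IsUnit a := by
        by_contra hu
        have ham : a ∈ maximalIdeal S := (IsLocalRing.mem_maximalIdeal _).mpr hu
        refine hΦ.left_not_mem_sq ?_
        rw [← hsum, pow_two]
        exact Ideal.add_mem _ (Ideal.mul_mem_mul ham hg₁') ((pow_two (maximalIdeal S)) ▸ Ideal.pow_le_pow_right hc₁ hm)
      obtain ⟨au, rfl⟩ := ha
      have hid : g₁' = ↑au⁻¹ * (g₁ - m) := by
        rw [← hsum, add_sub_cancel_right, ← mul_assoc, Units.inv_mul, one_mul]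
      rw [hid]
      exact Ideal.mul_mem_left _ _ (Ideal.sub_mem _ hself.1 (hpow₁ hm))
    · obtain rfl : r₁ = r₂ := le_antisymm hr h₂₁
      exact maximalIdeal_le_flagContactFiltration g₁ g₂ r₁ r₁ hq hg₁'

/-- **One-sided dominance gives EQUAL filtrations.** [OURS · L1 W4.3 · (o70-b)] -/
theorem flagContactFiltration_eq_of_oneSided {g₁ g₂ g₁' g₂' : S} {q r₁ r₂ : ℕ} (hΦ : IsTwoFlag g₁ g₂)
    (hadm : AdmissibleTriple q r₁ r₂) (hg₁' : g₁' ∈ maximalIdeal S) (hg₂' : g₂' ∈ maximalIdeal S)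
    (h₁ : g₁ ∈ flagContactFiltration g₁' g₂' q r₁ r₂ r₁) (h₂ : g₂ ∈ flagContactFiltration g₁' g₂' q r₁ r₂ r₂) (n : ℕ) :
    flagContactFiltration g₁' g₂' q r₁ r₂ n = flagContactFiltration g₁ g₂ q r₁ r₂ n := by
  obtain ⟨h₁', h₂'⟩ := hΦ.dominant_symm hadm hg₁' hg₂' h₁ h₂
  exact flagContactFiltration_eq_of_mem_of_mem hadm.1 h₁' h₂' h₁ h₂ n

end Iota3

end Summit.ResolutionOfSingularities.ResolutionOfSingularities.Cruxes.HypersurfaceCentreConstruction.LocalEngine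

end
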